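import Summits.ResolutionOfSingularities.ResolutionOfSingularities.Theorems.PurelyInseparableDim4PointQuadric
import Literature.AlgebraicGeometry.Resolution.MarkedIdealsEtale
import HarnessLib

/-!
# Purely inseparable four-folds: the conclusion of `OrderReduction p` for `F` is INVARIANT under `K`-automorphisms of
# `K[x₁, …, x₄]` — and every coordinate change of the quadric `x₁x₂ + x₃x₄` is resolved (brick TY-3k part 10
# «INVARIANCE», cell `res-dim4-pi`)

[OURS · counted 0] (D-0157 DOOR 2; a structural companion of the point-tree theorems; host item
stmt-ResolutionOfSingularities-16155, helper). Resolution of singularities in dimension ≥ 4 / characteristic `p` is NOT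
proved here or anywhere in this programme.

A `K`-algebra automorphism `τ` of `K[x₁, …, x₄]` extends to an automorphism `Θ` of `K[z, x₁, …, x₄]` fixing `z`, with
`Θ(z^p + F) = z^p + τ(F)`; `Spec Θ` is an automorphism of `𝔸⁵_K` pulling `(z^p + F)·𝒪` back to `(z^p + τ F)·𝒪`, and
marked resolutions pull back along étale morphisms (BGMW Thm. 8.0.5, tree `IsMarkedResolution.exists_isPullback_of_etale`).

* `exists_algEquiv_extend` — the extension `Θ` of `τ` (`Θ z = z`, `Θ ∘ (x ↦ x) = (x ↦ x) ∘ τ`);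
* **`exists_isMarkedResolution_of_algEquiv`** — a marked resolution of `(𝔸⁵_K, (z^p + F)·𝒪, [], p)` yields one of
  `(𝔸⁵_K, (z^p + τ F)·𝒪, [], p)`: the conclusion of `PIDim4.OrderReduction p` is a property of the ORBIT of `F`;
* **`exists_isMarkedResolution_quadric_of_algEquiv`** — every `z² + τ(x₁x₂ + x₃x₄)` (char `2`, `K = K̄`), in particular
  every linear coordinate change of the ordinary double point, admits a marked resolution.

AI-produced formalisation, weaker than expert review. bears_on: LADDER-RESOLUTION:D157-DOOR2 (res-dim4-pi · TY-3k).
-/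

set_option linter.dupNamespace false -- D-0017: single-problem summit path `Summit.<S>.<S>.…` by design

noncomputable section

open MvPolynomial Finset CategoryTheory AlgebraicGeometry Opposite TopologicalSpace

namespace Summit.ResolutionOfSingularities.ResolutionOfSingularities.Theorems.PIDim4

open Literature.AlgebraicGeometry.Resolution
open Literature.AlgebraicGeometry.Resolution.Hauser2010
open Literature.AlgebraicGeometry.Resolution.AffinePointBlowup (P A γ coord Wtop ξ)

namespace Equimultiple

section Invariance

variable {K : Type} [Field K] {p : ℕ}

/-- **Extending an automorphism of `K[x₁, …, x₄]` to `K[z, x₁, …, x₄]` fixing `z`.** [folklore] -/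
theorem exists_algEquiv_extend (τ : MvPolynomial (Fin 4) K ≃ₐ[K] MvPolynomial (Fin 4) K) :
    ∃ Θ : A 4 K ≃ₐ[K] A 4 K, Θ (X 0) = X 0 ∧
      ∀ G : MvPolynomial (Fin 4) K, Θ (rename Fin.succ G) = rename Fin.succ (τ G) := by
  -- the two candidate algebra maps
  let f : A 4 K →ₐ[K] A 4 K := aeval (Fin.cases (X 0) fun i => rename Fin.succ (τ (X i)))
  let g : A 4 K →ₐ[K] A 4 K := aeval (Fin.cases (X 0) fun i => rename Fin.succ (τ.symm (X i)))
  have hf : f.comp (rename Fin.succ) = (rename Fin.succ).comp (τ : MvPolynomial (Fin 4) K →ₐ[K] _) := by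
    refine MvPolynomial.algHom_ext fun i => ?_
    simp only [AlgHom.comp_apply, rename_X, AlgEquiv.coe_toAlgHom, f, aeval_X, Fin.cases_succ]
  have hg : g.comp (rename Fin.succ) = (rename Fin.succ).comp (τ.symm : MvPolynomial (Fin 4) K →ₐ[K] _) := by
    refine MvPolynomial.algHom_ext fun i => ?_
    simp only [AlgHom.comp_apply, rename_X, AlgEquiv.coe_toAlgHom, g, aeval_X, Fin.cases_succ]
  have hfG : ∀ G : MvPolynomial (Fin 4) K, f (rename Fin.succ G) = rename Fin.succ (τ G) := fun G => by
    have := DFunLike.congr_fun hf G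
    simpa only [AlgHom.comp_apply, AlgEquiv.coe_toAlgHom] using this
  have hgG : ∀ G : MvPolynomial (Fin 4) K, g (rename Fin.succ G) = rename Fin.succ (τ.symm G) := fun G => by
    have := DFunLike.congr_fun hg G
    simpa only [AlgHom.comp_apply, AlgEquiv.coe_toAlgHom] using this
  have hf0 : f (X 0) = X 0 := by simp only [f, aeval_X, Fin.cases_zero]
  have hg0 : g (X 0) = X 0 := by simp only [g, aeval_X, Fin.cases_zero]
  have h₁ : f.comp g = AlgHom.id K (A 4 K) := by
    refine MvPolynomial.algHom_ext fun k => ?_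
    refine Fin.cases ?_ (fun i => ?_) k
    · rw [AlgHom.comp_apply, AlgHom.id_apply, hg0, hf0]
    · rw [AlgHom.comp_apply, AlgHom.id_apply, ← rename_X Fin.succ i, hgG, hfG, AlgEquiv.apply_symm_apply]
  have h₂ : g.comp f = AlgHom.id K (A 4 K) := by
    refine MvPolynomial.algHom_ext fun k => ?_
    refine Fin.cases ?_ (fun i => ?_) k
    · rw [AlgHom.comp_apply, AlgHom.id_apply, hf0, hg0]
    · rw [AlgHom.comp_apply, AlgHom.id_apply, ← rename_X Fin.succ i, hfG, hgG, AlgEquiv.symm_apply_apply]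
  exact ⟨AlgEquiv.ofAlgHom f g h₁ h₂, hf0, hfG⟩

/-- **INVARIANCE of the conclusion of `OrderReduction p` under automorphisms of the base variables.** For every
`K`-algebra automorphism `τ` of `K[x₁, …, x₄]`: if `(𝔸⁵_K, (z^p + F)·𝒪, [], p)` admits a marked resolution then so does
`(𝔸⁵_K, (z^p + τ F)·𝒪, [], p)` (pull back along the automorphism `Spec Θ` of `𝔸⁵_K`, `Θ` the extension of `τ` fixing
`z`; marked resolutions pull back along étale morphisms, BGMW Thm. 8.0.5).
[cite: BierstoneGrigorievMilmanWlodarczyk2011, Thm. 8.0.5 (1)–(2) with Def. 3.1.3] -/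
theorem exists_isMarkedResolution_of_algEquiv (τ : MvPolynomial (Fin 4) K ≃ₐ[K] MvPolynomial (Fin 4) K)
    (F : MvPolynomial (Fin 4) K)
    (h : ∃ (X' : Scheme.{0}) (π : X' ⟶ P 4 K) (M' : MarkedIdeal X'),
      IsMarkedResolution (⟨hypSheaf p F, [], p⟩ : MarkedIdeal (P 4 K)) π M') :
    ∃ (X' : Scheme.{0}) (π : X' ⟶ P 4 K) (M' : MarkedIdeal X'),
      IsMarkedResolution (⟨hypSheaf p (τ F), [], p⟩ : MarkedIdeal (P 4 K)) π M' := by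
  obtain ⟨X', π, M', hres⟩ := h
  obtain ⟨Θ, hΘ0, hΘ⟩ := exists_algEquiv_extend τ
  haveI := isOpenImmersion_specMap_algEquiv Θ
  have hcomap : (hypSheaf p F).comap (Spec.map (CommRingCat.ofHom (Θ : A 4 K →+* A 4 K))) = hypSheaf p (τ F) := by
    rw [ChartDictionary.comap_hypSheaf_specMap, show (Θ : A 4 K →+* A 4 K) (hyp p F) = Θ (hyp p F) from rfl, hyp,
      map_add, map_pow, hΘ0, hΘ]
    rfl
  obtain ⟨Z', σ', ψ, -, hres'⟩ := hres.exists_isPullback_of_etale (Spec.map (CommRingCat.ofHom (Θ : A 4 K →+* A 4 K)))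
  dsimp only at hres'
  rw [hcomap, List.map_nil] at hres'
  exact ⟨Z', σ', _, hres'⟩

/-- **Every coordinate change of the four-fold double point is resolved**: for `K = K̄` of characteristic `2` and every
`K`-algebra automorphism `τ` of `K[x₁, …, x₄]` (e.g. an invertible linear substitution), the marked ideal
`(𝔸⁵_K, (z² + τ(x₁x₂ + x₃x₄))·𝒪, [], 2)` admits a marked resolution (BGMW Def. 3.1.3) — from
`exists_isMarkedResolution_quadric` by invariance. [cite: BierstoneGrigorievMilmanWlodarczyk2011, Def. 3.1.3 and Thm. 8.0.5] -/
theorem exists_isMarkedResolution_quadric_of_algEquiv [IsAlgClosed K] [CharP K 2] [DecidableEq K]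
    (τ : MvPolynomial (Fin 4) K ≃ₐ[K] MvPolynomial (Fin 4) K) :
    ∃ (X' : Scheme.{0}) (π : X' ⟶ P 4 K) (M' : MarkedIdeal X'),
      IsMarkedResolution (⟨hypSheaf 2 (τ (X 0 * X 1 + X 2 * X 3 : MvPolynomial (Fin 4) K)), [], 2⟩ :
        MarkedIdeal (P 4 K)) π M' :=
  exists_isMarkedResolution_of_algEquiv τ _ exists_isMarkedResolution_quadric

end Invariance

end Equimultiple

end Summit.ResolutionOfSingularities.ResolutionOfSingularities.Theorems.PIDim4

end
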